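import Literature.AlgebraicTopology.SingularHomology.ClopenAdditivity
import HarnessLib

/-!
# Additivity of singular cohomology over an arbitrary decomposition into disjoint open sets

A. Hatcher, *Algebraic Topology* (2002), §3.1 p. 202: "`Hⁿ(∐_α X_α; G) ≅ ∏_α Hⁿ(X_α; G)`"
(dual of Prop. 2.6, "a singular simplex always has path-connected image", so the singular chain
complex of a disjoint union of open subspaces is the direct sum of theirs). This is the
COHOMOLOGICAL dual of the tree's `ClopenAdditivity.lean` (which proves the HOMOLOGY statement
`⨁_k Hₙ(A k) ≃ Hₙ(Z)` for a clopen partition `IsClopenPartition A`, arbitrary index set; the tree's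
`DisjointUnion.lean` has the binary case `X ⊕ Y`): for a clopen partition `A : J → Set X`
(`IsClopenPartition A`: open, pairwise disjoint, covering) the restriction map
`Hⁿ(X; M) → ∏_j Hⁿ(↥(A j); M)` is a linear bijection (`singularCohomology.piRestrict_bijective`,
`singularCohomology.piRestrictEquiv`).

Proof (cochains are functions on simplices): every singular simplex of `X` lies in exactly one
piece (`IsClopenPartition.color`, `range_subset_color`, `color_eq_iff`, `color_face` of
`ClopenAdditivity.lean`, reused), so a family of cochains `ψ_j` on the subspaces GLUES to the
cochain `σ ↦ ψ_{j(σ)}(σ|)` (`glueCochain`), the coboundary of the glued cochain is the glueing of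
the coboundaries (`d_glueCochain_apply`, faces stay in the same piece), and restriction to `A j`
recovers `ψ_j` (`map_subsetIncl_glueCochain`). Surjectivity: glue cocycles; injectivity: glue the
primitives.

Everything is proved; no named facts. Used (for Milnor's countable cover by disjoint unions,
`Literature/Topology/DisjointCountableRefinement.lean`) to treat a disjoint union of trivialising
open sets of a bundle as a single open set in Mayer–Vietoris inductions.

## References

* A. Hatcher, *Algebraic Topology*, CUP 2002, §3.1 p. 202 and Prop. 2.6. [HatcherAT2002]
-/

noncomputable section

open CategoryTheory Set Function

universe u v w

namespace Literature.AlgebraicTopology.SingularHomology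

variable {R : Type v} [CommRing R] {M : Type v} [AddCommGroup M] [Module R M]
variable {X : Type u} [TopologicalSpace X] {J : Type w}

/-! ### Clopen partitions from disjoint open covers -/

/-- A family of pairwise disjoint sets covering `X` which are open is a clopen partition (the
hypothesis form `Pairwise (Disjoint on A)`, `⋃ j, A j = univ`). [folklore] -/
theorem IsClopenPartition.of_pairwise_disjoint {A : J → Set X}
    (hAo : ∀ j, IsOpen (A j)) (hdisj : Pairwise (Disjoint on A)) (hcov : ⋃ j, A j = univ) :
    IsClopenPartition A where
  isOpen := hAo
  disjoint _ _ hjk := hdisj hjk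
  exists_mem x := by
    have hx : x ∈ ⋃ j, A j := by rw [hcov]; exact mem_univ x
    exact mem_iUnion.1 hx

/-! ### Gluing cochains -/

section Glue

variable {A : J → Set X} (hA : IsClopenPartition A)

/-- **Gluing of cochains**: a family of cochains `ψ_j ∈ Cⁿ(A j; M)` on the (disjoint, open,
covering) pieces defines the cochain `σ ↦ ψ_{j(σ)}(σ|)` of `X` (Hatcher 2002, §3.1 p. 202: the
cochain complex of a disjoint union is the product). [cite: HatcherAT2002, §3.1 p. 202] -/
def glueCochain {n : ℕ} (ψ : (j : J) → (singularCochainComplex R M (A j)).X n) :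
    (singularCochainComplex R M X).X n :=
  fun σ : SingularSimplex X n ↦ ψ (hA.color σ) (SingularSimplex.codRestrict σ (A _) (hA.range_subset_color σ))

/-- The glued cochain on a simplex inside `A j` is `ψ_j` of that simplex. [folklore] -/
theorem glueCochain_apply {n : ℕ} (ψ : (j : J) → (singularCochainComplex R M (A j)).X n)
    (σ : SingularSimplex X n) {j : J} (h : σ.range ⊆ A j) :
    glueCochain (R := R) hA ψ σ = ψ j (σ.codRestrict (A j) h) := by
  have e := hA.color_eq_iff.2 h
  subst e
  rfl

/-- **The coboundary of a glued cochain is the glueing of the coboundaries** (all faces of a simplex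
in `A j` lie in `A j`). [cite: HatcherAT2002, §3.1 p. 202] -/
theorem d_glueCochain_apply {n : ℕ} (ψ : (j : J) → (singularCochainComplex R M (A j)).X n)
    (σ : SingularSimplex X (n + 1)) {j : J} (h : σ.range ⊆ A j) :
    (singularCochainComplex R M X).d n (n + 1) (glueCochain hA ψ) σ =
      (singularCochainComplex R M (A j)).d n (n + 1) (ψ j) (σ.codRestrict (A j) h) := by
  rw [singularCochainComplex.d_apply, singularCochainComplex.d_apply]
  refine Finset.sum_congr rfl fun i _ ↦ ?_
  rw [SingularSimplex.codRestrict_face, glueCochain_apply hA ψ _ ((σ.range_face_subset i).trans h)]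

/-- The coboundary of a glued cochain is the glued coboundary, as cochains. [cite: HatcherAT2002, §3.1 p. 202] -/
theorem d_glueCochain {n : ℕ} (ψ : (j : J) → (singularCochainComplex R M (A j)).X n) :
    (singularCochainComplex R M X).d n (n + 1) (glueCochain hA ψ) =
      glueCochain hA fun j ↦ (singularCochainComplex R M (A j)).d n (n + 1) (ψ j) := by
  refine funext fun σ ↦ ?_
  rw [d_glueCochain_apply (R := R) hA ψ σ (hA.range_subset_color σ)]
  rfl

/-- **Restricting a glued cochain to the piece `A j` recovers `ψ_j`**. [cite: HatcherAT2002, §3.1 p. 202] -/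
theorem map_subsetIncl_glueCochain {n : ℕ} (ψ : (j : J) → (singularCochainComplex R M (A j)).X n) (j : J) :
    (singularCochainComplex.map R M (subsetIncl (A j))).f n (glueCochain hA ψ) = ψ j := by
  refine funext fun τ ↦ ?_
  rw [singularCochainComplex.map_apply,
    glueCochain_apply hA ψ _ (SingularSimplex.range_map_val_subset (A j) τ)]
  exact congrArg (ψ j) (SingularSimplex.map_injective (f := subsetIncl (A j)) Subtype.val_injective
    (SingularSimplex.codRestrict_map_val _ _ _))

/-- A cochain of `X` is the glueing of its restrictions. [cite: HatcherAT2002, §3.1 p. 202] -/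
theorem glueCochain_map_subsetIncl {n : ℕ} (φ : (singularCochainComplex R M X).X n) :
    glueCochain hA (fun j ↦ (singularCochainComplex.map R M (subsetIncl (A j))).f n φ) = φ := by
  refine funext fun σ ↦ ?_
  exact congrArg φ (SingularSimplex.codRestrict_map_val σ _ _)

end Glue

/-! ### The restriction to the pieces is a bijection on cohomology -/

section Complex

variable {A : J → Set X} (hA : IsClopenPartition A)

include hA in
/-- **A cocycle restricting to coboundaries on every piece is a coboundary** (glue the primitives).
[cite: HatcherAT2002, §3.1 p. 202] -/
theorem homologyCls_eq_zero_of_forall {n : ℕ} (φ : (singularCochainComplex R M X).X n)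
    (hφ : (singularCochainComplex R M X).d n ((ComplexShape.up ℕ).next n) φ = 0)
    (h : ∀ j, HomologicalComplex.homologyMap (singularCochainComplex.map R M (subsetIncl (A j))) n
      (homologyCls φ hφ) = 0) :
    homologyCls φ hφ = 0 := by
  -- each restriction is a coboundary
  have hres : ∀ j, ∃ w : (singularCochainComplex R M (A j)).X ((ComplexShape.up ℕ).prev n),
      (singularCochainComplex R M (A j)).d _ n w =
        (singularCochainComplex.map R M (subsetIncl (A j))).f n φ := by
    intro j
    have hj := h j
    rw [homologyMap_homologyCls, homologyCls_eq_zero_iff] at hj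
    exact hj
  choose w hw using hres
  rw [homologyCls_eq_zero_iff]
  cases n with
  | zero =>
    -- no coboundaries into degree `0`: all restrictions vanish, hence `φ = 0`
    have hp : (ComplexShape.up ℕ).prev 0 = 0 := CochainComplex.prev_nat_zero
    have hd0 : ∀ (Y : Type u) [TopologicalSpace Y],
        (singularCochainComplex R M Y).d ((ComplexShape.up ℕ).prev 0) 0 = 0 := fun Y _ ↦
      (singularCochainComplex R M Y).shape _ _ (by rw [hp]; simp)
    refine ⟨0, ?_⟩
    rw [map_zero, ← glueCochain_map_subsetIncl (R := R) hA φ]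
    refine funext fun σ ↦ ?_
    change (0 : M) = ((singularCochainComplex.map R M (subsetIncl (A _))).f 0 φ) _
    rw [← hw, hd0]
    rfl
  | succ m =>
    have hp : (ComplexShape.up ℕ).prev (m + 1) = m := CochainComplex.prev_nat_succ m
    revert w
    rw [hp]
    intro w hw
    refine ⟨glueCochain hA w, ?_⟩
    rw [d_glueCochain, ← glueCochain_map_subsetIncl (R := R) hA φ]
    exact congrArg (glueCochain hA) (funext hw)

/-- The glueing of cocycles is a cocycle. [folklore] -/
theorem d_glueCochain_eq_zero {n : ℕ} (φ : (j : J) → (singularCochainComplex R M (A j)).X n)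
    (hφ : ∀ j, (singularCochainComplex R M (A j)).d n ((ComplexShape.up ℕ).next n) (φ j) = 0) :
    (singularCochainComplex R M X).d n ((ComplexShape.up ℕ).next n)
      (glueCochain hA φ) = 0 := by
  have hnext : (ComplexShape.up ℕ).next n = n + 1 := CochainComplex.next ℕ n
  rw [hnext, d_glueCochain]
  refine funext fun σ ↦ ?_
  change ((singularCochainComplex R M (A _)).d n (n + 1) (φ _)) _ = 0
  have := hφ (hA.color σ)
  rw [hnext] at this
  rw [this]
  rfl

/-- **Every family of classes on the pieces is the restriction of the class of a glued cocycle.**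
[cite: HatcherAT2002, §3.1 p. 202] -/
theorem homologyMap_homologyCls_glueCochain {n : ℕ} (φ : (j : J) → (singularCochainComplex R M (A j)).X n)
    (hφ : ∀ j, (singularCochainComplex R M (A j)).d n ((ComplexShape.up ℕ).next n) (φ j) = 0) (j : J) :
    HomologicalComplex.homologyMap (singularCochainComplex.map R M (subsetIncl (A j))) n
        (homologyCls (glueCochain hA φ) (d_glueCochain_eq_zero hA φ hφ)) =
      homologyCls (φ j) (hφ j) := by
  rw [homologyMap_homologyCls]
  exact homologyCls_congr (map_subsetIncl_glueCochain (R := R) hA φ j) _ _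

end Complex

namespace singularCohomology

variable (R M)
variable {A : J → Set X}

/-- **The restriction `Hⁿ(X; M) → ∏_j Hⁿ(A j; M)`** to the members of a family of subsets, as a
linear map. [cite: HatcherAT2002, §3.1 p. 202] -/
def piRestrict (A : J → Set X) (n : ℕ) :
    singularCohomology R M X n →ₗ[R] (j : J) → singularCohomology R M (A j) n :=
  LinearMap.pi fun j ↦ (singularCohomology.map R M (subsetIncl (A j)) n).hom

/-- Components of `piRestrict`. [folklore] -/
@[simp]
theorem piRestrict_apply (A : J → Set X) (n : ℕ) (x : singularCohomology R M X n) (j : J) :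
    piRestrict R M A n x j = singularCohomology.map R M (subsetIncl (A j)) n x := rfl

variable {R M}

/-- **Additivity of singular cohomology over a disjoint open decomposition** (Hatcher 2002, §3.1
p. 202, `Hⁿ(∐ X_α; G) ≅ ∏ Hⁿ(X_α; G)`, for the intrinsic decomposition of a space into pairwise
disjoint open subsets): the restriction `Hⁿ(X; M) → ∏_j Hⁿ(↥(A j); M)` is bijective. Surjective:
glue representing cocycles; injective: glue primitives. [cite: HatcherAT2002, §3.1 p. 202] -/
theorem piRestrict_bijective (hA : IsClopenPartition A) (n : ℕ) :
    Function.Bijective (piRestrict R M A n) := by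
  constructor
  · rw [injective_iff_map_eq_zero]
    intro x hx
    obtain ⟨φ, hφ, rfl⟩ := homologyCls_surjective (K := singularCochainComplex R M X) x
    exact homologyCls_eq_zero_of_forall hA φ hφ fun j ↦ congrFun hx j
  · intro y
    have hrep : ∀ j, ∃ (φ : (singularCochainComplex R M (A j)).X n)
        (hφ : (singularCochainComplex R M (A j)).d n ((ComplexShape.up ℕ).next n) φ = 0),
        homologyCls φ hφ = y j := fun j ↦ homologyCls_surjective (y j)
    choose φ hφ hy using hrep
    refine ⟨homologyCls (K := singularCochainComplex R M X) (glueCochain hA φ)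
      (d_glueCochain_eq_zero hA φ hφ), funext fun j ↦ ?_⟩
    rw [← hy j]
    exact homologyMap_homologyCls_glueCochain hA φ hφ j

/-- **`Hⁿ(X; M) ≃ₗ ∏_j Hⁿ(↥(A j); M)`** for a decomposition of `X` into pairwise disjoint open
subsets (Hatcher 2002, §3.1 p. 202). [cite: HatcherAT2002, §3.1 p. 202] -/
def piRestrictEquiv (hA : IsClopenPartition A) (n : ℕ) :
    singularCohomology R M X n ≃ₗ[R] (j : J) → singularCohomology R M (A j) n :=
  LinearEquiv.ofBijective (piRestrict R M A n) (piRestrict_bijective hA n)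

/-- The equivalence is restriction. [folklore] -/
@[simp]
theorem piRestrictEquiv_apply (hA : IsClopenPartition A) (n : ℕ) (x : singularCohomology R M X n) (j : J) :
    piRestrictEquiv hA n x j = singularCohomology.map R M (subsetIncl (A j)) n x := rfl

/-- Uniqueness form: a class restricting to `0` on every piece is `0`. [cite: HatcherAT2002, §3.1 p. 202] -/
theorem eq_zero_of_forall_map_subsetIncl_eq_zero (hA : IsClopenPartition A) {n : ℕ}
    {x : singularCohomology R M X n}
    (h : ∀ j, singularCohomology.map R M (subsetIncl (A j)) n x = 0) : x = 0 :=
  (piRestrict_bijective (R := R) (M := M) hA n).1 (funext fun j ↦ by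
    rw [piRestrict_apply, h j, map_zero]; rfl)

/-- Existence form: any family of classes on the pieces is the restriction of a class on `X`.
[cite: HatcherAT2002, §3.1 p. 202] -/
theorem exists_forall_map_subsetIncl_eq (hA : IsClopenPartition A) {n : ℕ}
    (y : (j : J) → singularCohomology R M (A j) n) :
    ∃ x : singularCohomology R M X n, ∀ j, singularCohomology.map R M (subsetIncl (A j)) n x = y j := by
  obtain ⟨x, hx⟩ := (piRestrict_bijective (R := R) (M := M) hA n).2 y
  exact ⟨x, fun j ↦ by rw [← piRestrict_apply R M A n x j, hx]⟩

end singularCohomology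

end Literature.AlgebraicTopology.SingularHomology
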